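import Mathlib
import HarnessLib
import Literature.MathematicalPhysics.StatisticalMechanics.ComplexGradientStiffness
import Summits.HubbardSuperconductivity.HubbardSuperconductivity.Theorems.ComplexGFFStiffnessDefs
import Summits.HubbardSuperconductivity.HubbardSuperconductivity.Theorems.ComplexGFFStiffnessHypACumulantPertK

/-!
# Crux `HypACumulant`, line `gnv` — the perturbed partition function is a genuine, real integral

Route `route-HubbardSuperconductivity-ComplexGFFStiffness`, crux item stmt-HubbardSuperconductivity-19154
(shared first rung with stmt-…-19155).  Zeroth layer of the research stub `stub_gnv : GNV`
(`…Theorems.ComplexGFF.GNV`): for an `ι`-admissible single-site perturbation `K` — indeed for any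
continuous `K` with the order-zero bound `‖K(z)‖ ≤ ρ·e^{Σ_i z_i²/4}` of `IsIotaAdmissible` — the
integrand `e^{−S_0(φ)} ∏_x (1 + K(∇φ(x)))` of `pertZ n K` is Lebesgue integrable on `ℝ^Λ` (the
weight `e^{½(1−ζ)𝒬}` at `ζ = 1/2` eats exactly half of the Gaussian decay), with the a-priori bound
`‖pertZ n K‖ ≤ (1+ρ)^{|Λ|} ∫ e^{−S_0/2}`; and the reflection symmetry `K(−z) = conj K(z)` makes
`pertZ n K` REAL.  So `GNV` is a statement about the sign of a real number continuous in `K`, and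
`pertZ n 0 = Z_n(0,0) > 0` fixes that sign at the origin of the ball.

## Contents (all proved; no definition, no named fact)
* `S_zero_neg`, `S_zero_smul`, `sum_sq_D_le_two_S` — evenness, homogeneity and the gradient part of
  the Gaussian action (re-derived; the Literature versions are private);
* `integrable_exp_neg_S`, `integrable_exp_neg_half_S` — `e^{−S_0}`, `e^{−S_0/2}` are integrable;
* `norm_prod_one_add_le`, `integrable_pertZ_integrand`, `norm_pertZ_le` — integrability and the
  a-priori bound for `‖K‖ ≤ ρ e^{|z|²/4}`;
* `pertZ_conj`, `pertZ_im` — reality under the `ι`-symmetry;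
* `pertK_zero`, `pertZ_zero_eq`, `pertZ_zero_pos` — the unperturbed value is `Z_n(0,0) > 0`.

## References
* S. Adams, S. Buchholz, R. Kotecký, S. Müller, arXiv:1910.13564, Sec. 2.1 (the role of `ζ > 0` in
  the weight of `E_{ζ,𝒬}`: integrability against `μ_𝒬`).
-/

noncomputable section

-- `Summit.<Summit>.<Problem>`: single-conjunct summit, the duplicate component is mandated (D-0017).
set_option linter.dupNamespace false

namespace Summit.HubbardSuperconductivity.HubbardSuperconductivity.Theorems.ComplexGFF

open scoped BigOperators ComplexConjugate
open MeasureTheory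
open Literature.MathematicalPhysics.StatisticalMechanics.ComplexGradientGFF4 (Z ev Y D S X w
  Z_zero_zero_pos)

variable {n : ℕ}

/-! ### The Gaussian action: evenness, homogeneity, gradient part -/

/-- the gradient is odd. -/
theorem D_neg (φ : (Fin 4 → ZMod n) → ℝ) (i : Fin 4) (s : Fin 4 → ZMod n) :
    D (-φ) i s = -(D φ i s) := by
  unfold D
  simp only [Pi.neg_apply]
  ring

/-- the gradient is linear under scaling. -/
theorem D_smul (r : ℝ) (φ : (Fin 4 → ZMod n) → ℝ) (i : Fin 4) (s : Fin 4 → ZMod n) :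
    D (r • φ) i s = r * D φ i s := by
  unfold D
  simp only [Pi.smul_apply, smul_eq_mul]
  ring

/-- `S_0(φ) = ½ Σ_{x,i} (∂_iφ(x))² + (Σ_x φ(x))²/(2|Λ|)`. -/
theorem S_zero_eq [NeZero n] (φ : (Fin 4 → ZMod n) → ℝ) :
    S 0 φ = (∑ s : Fin 4 → ZMod n, ∑ i : Fin 4, (D φ i s) ^ 2) / 2
      + (∑ s : Fin 4 → ZMod n, φ s) ^ 2 / (2 * (Fintype.card (Fin 4 → ZMod n) : ℝ)) := by
  unfold S
  simp only [Pi.zero_apply, add_zero]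

/-- `S_0` is even. -/
theorem S_zero_neg [NeZero n] (φ : (Fin 4 → ZMod n) → ℝ) : S 0 (-φ) = S 0 φ := by
  rw [S_zero_eq, S_zero_eq]
  simp only [D_neg, Pi.neg_apply, Finset.sum_neg_distrib, neg_sq]

/-- `S_0` is homogeneous of degree two. -/
theorem S_zero_smul [NeZero n] (r : ℝ) (φ : (Fin 4 → ZMod n) → ℝ) :
    S 0 (r • φ) = r ^ 2 * S 0 φ := by
  rw [S_zero_eq, S_zero_eq]
  simp only [D_smul, Pi.smul_apply, smul_eq_mul, mul_pow, ← Finset.mul_sum]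
  ring

/-- `0 ≤ S_0`. -/
theorem S_zero_nonneg [NeZero n] (φ : (Fin 4 → ZMod n) → ℝ) : 0 ≤ S 0 φ := by
  rw [S_zero_eq]
  positivity

/-- the gradient part of the action: `Σ_x Σ_i (∂_iφ(x))² ≤ 2 S_0(φ)`. -/
theorem sum_sq_D_le_two_S [NeZero n] (φ : (Fin 4 → ZMod n) → ℝ) :
    ∑ s : Fin 4 → ZMod n, ∑ i : Fin 4, (D φ i s) ^ 2 ≤ 2 * S 0 φ := by
  rw [S_zero_eq]
  have h : 0 ≤ (∑ s : Fin 4 → ZMod n, φ s) ^ 2 / (2 * (Fintype.card (Fin 4 → ZMod n) : ℝ)) := by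
    positivity
  linarith

/-! ### Integrability -/

/-- `e^{−S_0}` is integrable on `ℝ^Λ` (its integral is the positive number `Z_n(0,0)`). -/
theorem integrable_exp_neg_S (n : ℕ) [NeZero n] :
    Integrable (fun φ : (Fin 4 → ZMod n) → ℝ => Real.exp (-(S 0 φ))) := by
  by_contra h
  have h0 := Z_zero_zero_pos n
  rw [integral_undef h] at h0
  exact lt_irrefl 0 h0

/-- `e^{−S_0/2}` is integrable on `ℝ^Λ` (scale the field by `1/√2`). -/
theorem integrable_exp_neg_half_S (n : ℕ) [NeZero n] :
    Integrable (fun φ : (Fin 4 → ZMod n) → ℝ => Real.exp (-(S 0 φ) / 2)) := by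
  have hc : (Real.sqrt 2)⁻¹ ≠ 0 := inv_ne_zero (Real.sqrt_ne_zero'.mpr (by norm_num))
  have h := (integrable_comp_smul_iff volume (fun φ : (Fin 4 → ZMod n) → ℝ => Real.exp (-(S 0 φ)))
    hc).mpr (integrable_exp_neg_S n)
  refine h.congr (Filter.Eventually.of_forall (fun φ => ?_))
  simp only [S_zero_smul, inv_pow, Real.sq_sqrt (show (0:ℝ) ≤ 2 by norm_num)]
  congr 1
  ring

/-- pointwise bound on the product of single-site factors: if `‖K(z)‖ ≤ ρ e^{Σ z_i²/4}` then
`‖∏_x (1 + K(∇φ(x)))‖ ≤ (1+ρ)^{|Λ|} e^{S_0(φ)/2}`. -/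
theorem norm_prod_one_add_le [NeZero n] {K : (Fin 4 → ℝ) → ℂ} {ρ : ℝ} (hρ : 0 ≤ ρ)
    (hK : ∀ z : Fin 4 → ℝ, ‖K z‖ ≤ ρ * Real.exp ((∑ i : Fin 4, (z i) ^ 2) / 4))
    (φ : (Fin 4 → ZMod n) → ℝ) :
    ‖∏ x : Fin 4 → ZMod n, (1 + K (fun i => D φ i x))‖
      ≤ (1 + ρ) ^ Fintype.card (Fin 4 → ZMod n) * Real.exp (S 0 φ / 2) := by
  have hfac : ∀ x : Fin 4 → ZMod n,
      ‖1 + K (fun i => D φ i x)‖ ≤ (1 + ρ) * Real.exp ((∑ i : Fin 4, (D φ i x) ^ 2) / 4) := by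
    intro x
    have he : 1 ≤ Real.exp ((∑ i : Fin 4, (D φ i x) ^ 2) / 4) := Real.one_le_exp (by positivity)
    calc ‖1 + K (fun i => D φ i x)‖ ≤ ‖(1 : ℂ)‖ + ‖K (fun i => D φ i x)‖ := norm_add_le _ _
      _ ≤ 1 + ρ * Real.exp ((∑ i : Fin 4, (D φ i x) ^ 2) / 4) := by
          rw [norm_one]; linarith [hK (fun i => D φ i x)]
      _ ≤ (1 + ρ) * Real.exp ((∑ i : Fin 4, (D φ i x) ^ 2) / 4) := by nlinarith
  calc ‖∏ x : Fin 4 → ZMod n, (1 + K (fun i => D φ i x))‖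
      = ∏ x : Fin 4 → ZMod n, ‖1 + K (fun i => D φ i x)‖ := norm_prod _ _
    _ ≤ ∏ x : Fin 4 → ZMod n, (1 + ρ) * Real.exp ((∑ i : Fin 4, (D φ i x) ^ 2) / 4) :=
        Finset.prod_le_prod (fun x _ => norm_nonneg _) (fun x _ => hfac x)
    _ = (1 + ρ) ^ Fintype.card (Fin 4 → ZMod n)
          * Real.exp ((∑ x : Fin 4 → ZMod n, ∑ i : Fin 4, (D φ i x) ^ 2) / 4) := by
        rw [Finset.prod_mul_distrib, Finset.prod_const, Finset.card_univ, ← Real.exp_sum,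
          Finset.sum_div]
    _ ≤ (1 + ρ) ^ Fintype.card (Fin 4 → ZMod n) * Real.exp (S 0 φ / 2) :=
        mul_le_mul_of_nonneg_left (Real.exp_le_exp.mpr (by linarith [sum_sq_D_le_two_S φ]))
          (by positivity)

/-- **Integrability of the perturbed weight.** For continuous `K` with `‖K(z)‖ ≤ ρ e^{Σ z_i²/4}`
(in particular for every `ι`-admissible `K`), `φ ↦ e^{−S_0(φ)} ∏_x (1 + K(∇φ(x)))` is integrable
on `ℝ^Λ`, so `pertZ n K` is a genuine integral. -/
theorem integrable_pertZ_integrand (n : ℕ) [NeZero n] {K : (Fin 4 → ℝ) → ℂ} (hKc : Continuous K)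
    {ρ : ℝ} (hρ : 0 ≤ ρ)
    (hK : ∀ z : Fin 4 → ℝ, ‖K z‖ ≤ ρ * Real.exp ((∑ i : Fin 4, (z i) ^ 2) / 4)) :
    Integrable (fun φ : (Fin 4 → ZMod n) → ℝ =>
      Complex.exp (-((S 0 φ : ℝ) : ℂ)) * ∏ x : Fin 4 → ZMod n, (1 + K (fun i => D φ i x))) := by
  have hD : ∀ (i : Fin 4) (x : Fin 4 → ZMod n),
      Continuous (fun φ : (Fin 4 → ZMod n) → ℝ => D φ i x) := fun i x => by unfold D; fun_prop
  have hS : Continuous (fun φ : (Fin 4 → ZMod n) → ℝ => S 0 φ) := by unfold S D; fun_prop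
  have hcont : Continuous (fun φ : (Fin 4 → ZMod n) → ℝ =>
      Complex.exp (-((S 0 φ : ℝ) : ℂ)) * ∏ x : Fin 4 → ZMod n, (1 + K (fun i => D φ i x))) := by
    refine (Complex.continuous_exp.comp (Complex.continuous_ofReal.comp hS).neg).mul ?_
    refine continuous_finsetProd _ (fun x _ => continuous_const.add (hKc.comp ?_))
    exact continuous_pi (fun i => hD i x)
  refine (((integrable_exp_neg_half_S n).const_mul
    ((1 + ρ) ^ Fintype.card (Fin 4 → ZMod n)))).mono' hcont.aestronglyMeasurable
    (Filter.Eventually.of_forall (fun φ => ?_))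
  rw [norm_mul, Complex.norm_exp]
  simp only [Complex.neg_re, Complex.ofReal_re]
  calc Real.exp (-S 0 φ) * ‖∏ x : Fin 4 → ZMod n, (1 + K (fun i => D φ i x))‖
      ≤ Real.exp (-S 0 φ) * ((1 + ρ) ^ Fintype.card (Fin 4 → ZMod n) * Real.exp (S 0 φ / 2)) :=
        mul_le_mul_of_nonneg_left (norm_prod_one_add_le hρ hK φ) (Real.exp_pos _).le
    _ = (1 + ρ) ^ Fintype.card (Fin 4 → ZMod n) * Real.exp (-(S 0 φ) / 2) := by
        rw [mul_left_comm, ← Real.exp_add]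
        congr 2
        ring

/-- **A-priori bound** `‖pertZ n K‖ ≤ (1+ρ)^{|Λ|} ∫ e^{−S_0/2}` under the order-zero admissibility
bound (volume-dependent; the content of `GNV` is uniformity in the volume). -/
theorem norm_pertZ_le (n : ℕ) [NeZero n] {K : (Fin 4 → ℝ) → ℂ} {ρ : ℝ} (hρ : 0 ≤ ρ)
    (hK : ∀ z : Fin 4 → ℝ, ‖K z‖ ≤ ρ * Real.exp ((∑ i : Fin 4, (z i) ^ 2) / 4)) :
    ‖pertZ n K‖ ≤ (1 + ρ) ^ Fintype.card (Fin 4 → ZMod n)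
      * ∫ φ : (Fin 4 → ZMod n) → ℝ, Real.exp (-(S 0 φ) / 2) := by
  unfold pertZ
  rw [← integral_const_mul]
  refine norm_integral_le_of_norm_le ((integrable_exp_neg_half_S n).const_mul _)
    (Filter.Eventually.of_forall (fun φ => ?_))
  rw [norm_mul, Complex.norm_exp]
  simp only [Complex.neg_re, Complex.ofReal_re]
  calc Real.exp (-S 0 φ) * ‖∏ x : Fin 4 → ZMod n, (1 + K (fun i => D φ i x))‖
      ≤ Real.exp (-S 0 φ) * ((1 + ρ) ^ Fintype.card (Fin 4 → ZMod n) * Real.exp (S 0 φ / 2)) :=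
        mul_le_mul_of_nonneg_left (norm_prod_one_add_le hρ hK φ) (Real.exp_pos _).le
    _ = (1 + ρ) ^ Fintype.card (Fin 4 → ZMod n) * Real.exp (-(S 0 φ) / 2) := by
        rw [mul_left_comm, ← Real.exp_add]
        congr 2
        ring

/-! ### Reality under the `ι`-symmetry -/

/-- **Reality.** If `K(−z) = conj K(z)` then `conj (pertZ n K) = pertZ n K` (field reflection
`φ ↦ −φ`, Lebesgue measure being reflection invariant; no integrability needed). -/
theorem pertZ_conj (n : ℕ) [NeZero n] {K : (Fin 4 → ℝ) → ℂ}
    (hK : ∀ z : Fin 4 → ℝ, K (-z) = conj (K z)) : conj (pertZ n K) = pertZ n K := by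
  unfold pertZ
  rw [← integral_conj]
  have h := integral_neg_eq_self (fun φ : (Fin 4 → ZMod n) → ℝ =>
    Complex.exp (-((S 0 φ : ℝ) : ℂ)) * ∏ x : Fin 4 → ZMod n, (1 + K (fun i => D φ i x))) volume
  rw [← h]
  congr 1
  ext φ
  rw [map_mul, map_prod, S_zero_neg, ← Complex.exp_conj, map_neg, Complex.conj_ofReal]
  congr 1
  refine Finset.prod_congr rfl (fun x _ => ?_)
  rw [map_add, map_one, ← hK]
  congr 2
  funext i
  simp only [D_neg, Pi.neg_apply]

/-- hence `pertZ n K` is real. -/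
theorem pertZ_im (n : ℕ) [NeZero n] {K : (Fin 4 → ℝ) → ℂ}
    (hK : ∀ z : Fin 4 → ℝ, K (-z) = conj (K z)) : (pertZ n K).im = 0 :=
  Complex.conj_eq_iff_im.mp (pertZ_conj n hK)

/-! ### The unperturbed value -/

/-- `𝒦_0 = 0`. -/
theorem pertK_zero : pertK 0 = fun _ => 0 := by
  funext z
  simp [pertK]

/-- `pertZ n 0 = Z_n(0,0)`. -/
theorem pertZ_zero_eq (n : ℕ) [NeZero n] : pertZ n (fun _ => 0) = Z n 0 0 := by
  rw [← pertK_zero, pertZ_pertK]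

/-- `pertZ n 0 = Z_n(0,0)` is a positive real: `0 < Re`, `Im = 0`. -/
theorem pertZ_zero_pos (n : ℕ) [NeZero n] :
    0 < (pertZ n (fun _ => 0)).re ∧ (pertZ n (fun _ => 0)).im = 0 := by
  have h : pertZ n (fun _ => 0)
      = ((∫ φ : (Fin 4 → ZMod n) → ℝ, Real.exp (-(S 0 φ)) : ℝ) : ℂ) := by
    unfold pertZ
    rw [← integral_complex_ofReal]
    refine integral_congr_ae (Filter.Eventually.of_forall (fun φ => ?_))
    simp only [add_zero, Finset.prod_const_one, mul_one, Complex.ofReal_exp, Complex.ofReal_neg]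
  rw [h]
  exact ⟨by rw [Complex.ofReal_re]; exact Z_zero_zero_pos n, Complex.ofReal_im _⟩

end Summit.HubbardSuperconductivity.HubbardSuperconductivity.Theorems.ComplexGFF

end
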